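import Literature.NumberTheory.Sieve.MaynardOperatorRayleigh
import HarnessLib

/-!
# The Krylov moments `⟨ℒⁿ1, 1⟩` of Polymath's operator bound the Maynard functional: `ℒ` is
# self-adjoint, positive semi-definite and positivity-preserving on `L²(R_k)`

Topic `Literature/NumberTheory/Sieve`; companion of `MaynardCollatzWielandt.lean` (the operator
`ℒ = ∑_m P_m`, `MaynardCW.maynardOperator`) and `MaynardOperatorRayleigh.lean`
(`∑_m J^{(m)}(F) = ⟨ℒF, F⟩`, `maynardFunctional_eq_rayleigh`).  Source: D. H. J. Polymath, *Variants of
the Selberg sieve, and bounded intervals containing many primes*, Res. Math. Sci. 1:12 (2014)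
= arXiv:1407.4897v4, **§7.1, p. 30**: «This is a self-adjoint and positive semi-definite operator on
`L²(R_k)`. … If we then choose `b_i := ℒ^{i−1}1` where `1` is the unit constant function on `R_k`, then
the matrices `M_1, M_2` take the Hankel form … and so can be computed entirely in terms of the `2n`
numbers `⟨ℒ^i 1, 1⟩` … leading to lower bounds on `M_k`» (the Krylov subspace method behind the
printed Table of lower bounds for `M_k`, `k ≤ 100`), together with the convergence theory of Ritz
values on Krylov spaces (Golub–Van Loan, *Matrix Computations*, 4th ed., §10.1.5, Theorem 10.1.2,
Kaniel–Paige–Saad: `λ₁ ≥ θ₁ ≥ λ₁ − (λ₁ − λ_n)(tan φ₁ / c_{k−1}(1 + 2ρ₁))²`).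

What this file proves (no named facts; everything from the tree's `ℒ`):

* `MaynardCW.integral_fibreIntegral_mul_eq` — the bilinear fibre identity
  `∫ (P_m F)·G = ∫_{s} (∫_{fibre} F)(∫_{fibre} G)`, hence **self-adjointness**
  `∫ (P_m F)·G = ∫ (P_m G)·F` (`integral_fibreIntegral_mul_comm`) and
  `∫ (ℒF)·G = ∫ (ℒG)·F` (`integral_maynardOperator_mul_comm`), and **positive semi-definiteness**
  `0 ≤ ∫ (ℒF)·F` (`integral_maynardOperator_mul_self_nonneg`) — the two properties asserted on p. 30,
  for `F, G` measurable, bounded and supported on `R_{n+1}`.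
* `MaynardCW.krylovStep F = 1_{R}·ℒF` (the operator of `L²(R_k)`: `ℒ` followed by restriction to
  `R_k`), its iterates `krylovIter N F`, the Krylov vectors `krylovIter N 1_R = ℒ^N 1` and the
  **Krylov moments** `krylovMoment N = ⟨ℒ^N 1, 1⟩ = ∫_{R} ℒ^N 1` of §7.1; measurability / support /
  bounds of the iterates; **positivity preservation** `|ℒ^N F| ≤ B·ℒ^N 1` for `|F| ≤ B`
  (`abs_krylovIter_le`).
* `MaynardCW.sq_integral_krylovIter_mul_le` — the moment inequality
  `⟨ℒ^j F, F⟩² ≤ ⟨ℒ^{2j} F, F⟩·⟨F, F⟩` (Cauchy–Schwarz plus `⟨ℒ^jF, ℒ^jF⟩ = ⟨ℒ^{2j}F, F⟩`), and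
  `pow_integral_krylovIter_one_mul_le` — `⟨ℒF, F⟩^{2^s} ≤ ⟨ℒ^{2^s}F, F⟩·⟨F, F⟩^{2^s − 1}`.
* **`maynardFunctional_pow_mul_maynardI_le_krylovMoment`** — for every test function `F` that is
  measurable, supported on `R_{n+1}` and bounded by `B` there, and every `s`,
  `((∑_m J^{(m)}(F))/I(F))^{2^s} · I(F) ≤ B² · ⟨ℒ^{2^s} 1, 1⟩`.
  CONSEQUENCE (the point of the file): the Krylov moments of the single vector `1` control `M_k`
  from ABOVE as well as from below — every bounded admissible `F` has
  `(∑J/I)(F) ≤ (B²/I(F))^{2^{−s}} · ⟨ℒ^{2^s}1,1⟩^{2^{−s}}` for all `s`, so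
  `M_k ≤ liminf_N ⟨ℒ^N 1,1⟩^{1/N}`; together with the easy direction (`⟨ℒ^N1,1⟩ ≤ M_k^N ⟨1,1⟩`, the
  Rayleigh quotients of the Krylov vectors being values of admissible functions) this is the
  folklore fact «for a positivity-preserving positive self-adjoint operator the local spectral radius
  at the (quasi-interior) vector `1` is the spectral radius», i.e. the Ritz values of the Krylov
  method from the seed `1` converge to `M_k` itself and not merely to the top of the cyclic subspace
  of `1` — the caveat left implicit on p. 30 («leading to lower bounds on `M_k`»).  Only the
  inequality is formalised; no limit statement is needed by its users (a certified numerical upper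
  bound for `⟨ℒ^{2^s}1,1⟩` at one `s` already bounds every bounded test function's value).

Conventions: functions are `(Fin (n + 1) → ℝ) → ℝ`, "supported on `R_{n+1}`" is
`∀ t ∉ R_{n+1}, F t = 0`, bounds are `∀ t ∈ R_{n+1}, |F t| ≤ B` — exactly as in the two companion
files; `1` is `(maynardSimplex (n+1)).indicator 1`.

## References

* [Polymath8b2014] D. H. J. Polymath, *op. cit.*, §7.1 p. 30 (the operator `ℒ`, «self-adjoint and
  positive semi-definite», the Krylov basis `b_i = ℒ^{i−1}1`, the moments `⟨ℒ^i1,1⟩`).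
* [GolubVanLoan2013] G. H. Golub, C. F. Van Loan, *Matrix Computations*, 4th ed., §10.1.5,
  Theorem 10.1.2 (Ritz values of the Lanczos/Krylov process: `θ₁ ≤ λ₁` and the Kaniel–Paige bound).

## Mathlib / tree search

Tree: `MaynardCW.fibreIntegral`, `maynardOperator`, `fibreIntegral_insertNth`,
`measurable_fibreIntegral`, `measurable_maynardOperator` (`MaynardCollatzWielandt`);
`maynardFunctional_eq_rayleigh` (`MaynardOperatorRayleigh`);
`MaynardLargeK.insertNth_mem_maynardSimplex_iff` (`MaynardTaoLargeKProofs`); `volume_preserving_piFinSuccAbove`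
(Mathlib).  `lean search 'krylov|integral_maynardOperator_mul_comm|self_adjoint.*maynard'`: nothing
before this file.  The real Cauchy–Schwarz `(∫fg)² ≤ ∫f²∫g²` exists in the tree only inside
`Literature/Analysis/FluidPDE/HydrodynamicLimitProofs` (`sq_integral_mul_le_integral_sq_mul_integral_sq`);
it is re-proved privately here to keep the sieve import closure small.
-/

noncomputable section

open MeasureTheory Set Filter Finset
open scoped ENNReal BigOperators

namespace Literature.NumberTheory.Sieve

namespace MaynardCW

variable {n : ℕ}

/-! ### Private helpers (sections of functions supported on `R_{n+1}`) -/

/-- If `F` vanishes off `R_{n+1}`, the whole-line section integral over a fibre equals the fibre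
integral over `(0, 1 − ∑ s]`. [folklore] -/
private theorem integral_section_eq (m : Fin (n + 1)) {F : (Fin (n + 1) → ℝ) → ℝ}
    (hF : ∀ t, t ∉ maynardSimplex (n + 1) → F t = 0) (s : Fin n → ℝ) :
    (∫ u, F (Fin.insertNth m u s)) = ∫ u in Ioc (0:ℝ) (1 - ∑ j, s j), F (Fin.insertNth m u s) := by
  have hzero : ∀ u, ¬ ((0 ≤ u ∧ ∀ j, 0 ≤ s j) ∧ u + ∑ j, s j ≤ 1) → F (Fin.insertNth m u s) = 0 :=
    fun u hu => hF _ fun h => hu ((MaynardLargeK.insertNth_mem_maynardSimplex_iff m u s).1 h)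
  by_cases hs : (∀ j, 0 ≤ s j) ∧ ∑ j, s j ≤ 1
  · have hIcc : (∫ u, F (Fin.insertNth m u s)) =
        ∫ u in Icc (0:ℝ) (1 - ∑ j, s j), F (Fin.insertNth m u s) := by
      refine (setIntegral_eq_integral_of_forall_compl_eq_zero fun u hu => hzero u fun h => hu ?_).symm
      exact ⟨h.1.1, by linarith [h.2]⟩
    rw [hIcc, integral_Icc_eq_integral_Ioc]
  · have hz : ∀ u, F (Fin.insertNth m u s) = 0 := fun u =>
      hzero u fun h => hs ⟨h.1.2, by linarith [h.2, h.1.1]⟩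
    simp [hz]

/-- For `F` vanishing off `R_{n+1}` and bounded by `B` there, `|P_m F| ≤ B` along every fibre.
[folklore] -/
private theorem abs_fibreIntegral_insertNth_le' (m : Fin (n + 1)) {F : (Fin (n + 1) → ℝ) → ℝ}
    (hF : ∀ t, t ∉ maynardSimplex (n + 1) → F t = 0) {B : ℝ} (hB0 : 0 ≤ B)
    (hB : ∀ t ∈ maynardSimplex (n + 1), |F t| ≤ B) (u : ℝ) (s : Fin n → ℝ) :
    |fibreIntegral m F (Fin.insertNth m u s)| ≤ B := by
  rw [fibreIntegral_insertNth]
  have hpt : ∀ v, |F (Fin.insertNth m v s)| ≤ B := fun v => by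
    by_cases hv : Fin.insertNth m v s ∈ maynardSimplex (n + 1)
    · exact hB _ hv
    · rw [hF _ hv, abs_zero]; exact hB0
  by_cases hs : ∀ j, 0 ≤ s j
  · have hsum : 0 ≤ ∑ j, s j := Finset.sum_nonneg fun j _ => hs j
    by_cases hL : 0 ≤ 1 - ∑ j, s j
    · have hvol : volume (Ioc (0:ℝ) (1 - ∑ j, s j)) < ⊤ := by simp [Real.volume_Ioc]
      calc |∫ v in Ioc (0:ℝ) (1 - ∑ j, s j), F (Fin.insertNth m v s)|
          ≤ B * (volume : Measure ℝ).real (Ioc (0:ℝ) (1 - ∑ j, s j)) := by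
            rw [← Real.norm_eq_abs]
            exact norm_setIntegral_le_of_norm_le_const hvol fun v _ => by
              rw [Real.norm_eq_abs]; exact hpt v
        _ ≤ B * 1 := by
            refine mul_le_mul_of_nonneg_left ?_ hB0
            rw [Measure.real, Real.volume_Ioc, sub_zero, ENNReal.toReal_ofReal hL]
            linarith
        _ = B := mul_one B
    · rw [Ioc_eq_empty (fun h => hL (le_of_lt h)), Measure.restrict_empty, integral_zero_measure,
        abs_zero]
      exact hB0
  · -- some `s_j < 0`: the fibre misses `R_{n+1}` and the section vanishes
    have hz : ∀ v, F (Fin.insertNth m v s) = 0 := fun v => hF _ fun h =>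
      hs ((MaynardLargeK.insertNth_mem_maynardSimplex_iff m v s).1 h).1.2
    simp [hz, hB0]

/-- `|ℒF| ≤ (n+1)·B` everywhere, for `F` vanishing off `R_{n+1}` and bounded by `B ≥ 0` there.
[folklore] -/
private theorem abs_maynardOperator_le {F : (Fin (n + 1) → ℝ) → ℝ}
    (hF : ∀ t, t ∉ maynardSimplex (n + 1) → F t = 0) {B : ℝ} (hB0 : 0 ≤ B)
    (hB : ∀ t ∈ maynardSimplex (n + 1), |F t| ≤ B) (t : Fin (n + 1) → ℝ) :
    |maynardOperator F t| ≤ (n + 1) * B := by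
  rw [maynardOperator_def]
  refine (Finset.abs_sum_le_sum_abs _ _).trans ?_
  calc ∑ m, |fibreIntegral m F t| ≤ ∑ _m : Fin (n + 1), B := Finset.sum_le_sum fun m _ => by
          rw [← Fin.insertNth_self_removeNth m t]; exact abs_fibreIntegral_insertNth_le' m hF hB0 hB _ _
    _ = (n + 1) * B := by simp

/-- `F` measurable, bounded and vanishing off `R_{n+1}` is integrable. [folklore] -/
private theorem integrable_of_bdd {F : (Fin (n + 1) → ℝ) → ℝ} (hFm : Measurable F)
    (hF : ∀ t, t ∉ maynardSimplex (n + 1) → F t = 0) {B : ℝ}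
    (hB : ∀ t ∈ maynardSimplex (n + 1), |F t| ≤ B) : Integrable F := by
  refine IntegrableOn.integrable_of_forall_notMem_eq_zero (s := maynardSimplex (n + 1)) ?_ hF
  refine IntegrableOn.of_bound (isCompact_maynardSimplex (n + 1)).measure_lt_top
    hFm.aestronglyMeasurable B ?_
  rw [ae_restrict_iff' (measurableSet_maynardSimplex (n + 1))]
  exact ae_of_all _ fun t ht => by rw [Real.norm_eq_abs]; exact hB t ht

/-- A bound on `R_{n+1}` is nonnegative (evaluate at the origin). [folklore] -/
private theorem bound_nonneg {F : (Fin (n + 1) → ℝ) → ℝ} {B : ℝ}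
    (hB : ∀ t ∈ maynardSimplex (n + 1), |F t| ≤ B) : 0 ≤ B := by
  have h0 : (fun _ => (0:ℝ)) ∈ maynardSimplex (n + 1) := ⟨fun _ => le_rfl, by simp⟩
  exact (abs_nonneg _).trans (hB _ h0)

/-- The product of a measurable function bounded by `B'` everywhere with an integrable-type bounded
supported function is integrable: `∫ P·G` makes sense. [folklore] -/
private theorem integrable_mul_of_bdd {P G : (Fin (n + 1) → ℝ) → ℝ} (hPm : Measurable P) {B' : ℝ}
    (hP : ∀ t, |P t| ≤ B') (hGm : Measurable G)
    (hG : ∀ t, t ∉ maynardSimplex (n + 1) → G t = 0) {B : ℝ}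
    (hB : ∀ t ∈ maynardSimplex (n + 1), |G t| ≤ B) : Integrable fun t => P t * G t :=
  (integrable_of_bdd hGm hG hB).bdd_mul hPm.aestronglyMeasurable
    (ae_of_all _ fun t => by rw [Real.norm_eq_abs]; exact hP t)

/-- Cauchy–Schwarz for real integrals: `(∫ f g)² ≤ (∫ f²)(∫ g²)`. [folklore] -/
private theorem sq_integral_mul_le {α : Type*} [MeasurableSpace α] {μ : Measure α} {f g : α → ℝ}
    (hf2 : Integrable (fun x => f x ^ 2) μ) (hg2 : Integrable (fun x => g x ^ 2) μ)
    (hfg : Integrable (fun x => f x * g x) μ) :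
    (∫ x, f x * g x ∂μ) ^ 2 ≤ (∫ x, f x ^ 2 ∂μ) * (∫ x, g x ^ 2 ∂μ) := by
  set A := ∫ x, f x ^ 2 ∂μ with hA
  set Bv := ∫ x, f x * g x ∂μ with hB
  set C := ∫ x, g x ^ 2 ∂μ with hC
  have hA0 : 0 ≤ A := integral_nonneg fun x => sq_nonneg _
  have key : 0 ≤ A * (A * C - Bv ^ 2) := by
    have h1 : 0 ≤ ∫ x, (Bv * f x - A * g x) ^ 2 ∂μ := integral_nonneg fun x => sq_nonneg _
    have e : (fun x => (Bv * f x - A * g x) ^ 2) =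
        fun x => Bv ^ 2 * f x ^ 2 - 2 * (Bv * A) * (f x * g x) + A ^ 2 * g x ^ 2 := by
      funext x; ring
    have i1 : Integrable (fun x => Bv ^ 2 * f x ^ 2) μ := hf2.const_mul _
    have i2 : Integrable (fun x => 2 * (Bv * A) * (f x * g x)) μ := hfg.const_mul _
    have i12 : Integrable (fun x => Bv ^ 2 * f x ^ 2 - 2 * (Bv * A) * (f x * g x)) μ := i1.sub i2
    have i3 : Integrable (fun x => A ^ 2 * g x ^ 2) μ := hg2.const_mul _
    rw [e, integral_add i12 i3, integral_sub i1 i2, integral_const_mul, integral_const_mul,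
      integral_const_mul] at h1
    nlinarith
  rcases hA0.lt_or_eq with hA1 | hA1
  · nlinarith
  · have hf0 : (fun x => f x ^ 2) =ᵐ[μ] 0 :=
      (integral_eq_zero_iff_of_nonneg (fun x => sq_nonneg (f x)) hf2).1 hA1.symm
    have hB0 : Bv = 0 := by
      have h0 : (fun x => f x * g x) =ᵐ[μ] 0 := by
        filter_upwards [hf0] with x hx
        have hfx : f x = 0 := (pow_eq_zero_iff two_ne_zero).1 hx
        simp [hfx]
      rw [hB, integral_congr_ae h0]
      simp
    rw [hB0, ← hA1]
    simp

/-! ### Self-adjointness and positivity of `P_m` and `ℒ` (Polymath 8b §7.1, p. 30) -/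

/-- **The bilinear fibre identity.**  For `F, G` measurable, bounded and supported on `R_{n+1}`,
`∫ (P_m F)(t) G(t) dt = ∫_{s ∈ ℝⁿ} (∫_{(0,1−∑s]} F(s,v) dv)(∫_{(0,1−∑s]} G(s,v) dv) ds` (Fubini along the
`m`-th coordinate; `P_m F` is constant on each fibre).  The right side is symmetric in `F, G`: this is
the self-adjointness of `P_m` («a self-adjoint … operator on `L²(R_k)`»).
[cite: Polymath8b2014, §7.1 (p. 30)] -/
theorem integral_fibreIntegral_mul_eq (m : Fin (n + 1)) {F G : (Fin (n + 1) → ℝ) → ℝ}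
    (hFm : Measurable F) (hF : ∀ t, t ∉ maynardSimplex (n + 1) → F t = 0) {B : ℝ}
    (hB : ∀ t ∈ maynardSimplex (n + 1), |F t| ≤ B)
    (hGm : Measurable G) (hG : ∀ t, t ∉ maynardSimplex (n + 1) → G t = 0) {B' : ℝ}
    (hB' : ∀ t ∈ maynardSimplex (n + 1), |G t| ≤ B') :
    ∫ t, fibreIntegral m F t * G t =
      ∫ s : Fin n → ℝ, (∫ v in Ioc (0:ℝ) (1 - ∑ j, s j), F (Fin.insertNth m v s)) *
        (∫ v in Ioc (0:ℝ) (1 - ∑ j, s j), G (Fin.insertNth m v s)) := by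
  have hB0 : 0 ≤ B := bound_nonneg hB
  set g : (Fin (n + 1) → ℝ) → ℝ := fun t => fibreIntegral m F t * G t with hg
  have hPbdd : ∀ t, |fibreIntegral m F t| ≤ B := fun t => by
    rw [← Fin.insertNth_self_removeNth m t]; exact abs_fibreIntegral_insertNth_le' m hF hB0 hB _ _
  have hgint : Integrable g :=
    integrable_mul_of_bdd (measurable_fibreIntegral m hFm) hPbdd hGm hG hB'
  set e := MeasurableEquiv.piFinSuccAbove (fun _ : Fin (n + 1) => ℝ) m with he_def
  have he : MeasurePreserving e.symm ((volume : Measure ℝ).prod volume) volume := by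
    have h := (volume_preserving_piFinSuccAbove (fun _ : Fin (n + 1) => ℝ) m).symm
    rwa [Measure.volume_eq_prod] at h
  have he_apply : ∀ p : ℝ × (Fin n → ℝ), e.symm p = Fin.insertNth m p.1 p.2 := fun p => by
    rw [he_def, MeasurableEquiv.piFinSuccAbove_symm_apply]; rfl
  rw [← he.integral_comp e.symm.measurableEmbedding g]
  have hgi : Integrable (g ∘ e.symm) ((volume : Measure ℝ).prod volume) :=
    (he.integrable_comp_emb e.symm.measurableEmbedding).2 hgint
  rw [show (fun x => g (e.symm x)) = g ∘ e.symm from rfl, integral_prod_symm _ hgi]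
  refine integral_congr_ae (ae_of_all _ fun s => ?_)
  dsimp only [Function.comp]
  simp_rw [he_apply]
  show ∫ u, fibreIntegral m F (Fin.insertNth m u s) * G (Fin.insertNth m u s) = _
  simp_rw [fibreIntegral_insertNth]
  rw [integral_const_mul, integral_section_eq m hG s]

/-- **`P_m` is self-adjoint**: `∫ (P_m F)·G = ∫ (P_m G)·F` for `F, G` measurable, bounded and supported
on `R_{n+1}`. [cite: Polymath8b2014, §7.1 (p. 30)] -/
theorem integral_fibreIntegral_mul_comm (m : Fin (n + 1)) {F G : (Fin (n + 1) → ℝ) → ℝ}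
    (hFm : Measurable F) (hF : ∀ t, t ∉ maynardSimplex (n + 1) → F t = 0) {B : ℝ}
    (hB : ∀ t ∈ maynardSimplex (n + 1), |F t| ≤ B)
    (hGm : Measurable G) (hG : ∀ t, t ∉ maynardSimplex (n + 1) → G t = 0) {B' : ℝ}
    (hB' : ∀ t ∈ maynardSimplex (n + 1), |G t| ≤ B') :
    ∫ t, fibreIntegral m F t * G t = ∫ t, fibreIntegral m G t * F t := by
  rw [integral_fibreIntegral_mul_eq m hFm hF hB hGm hG hB',
    integral_fibreIntegral_mul_eq m hGm hG hB' hFm hF hB]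
  simp_rw [mul_comm]

/-- **`ℒ` is self-adjoint**: `∫ (ℒF)·G = ∫ (ℒG)·F` for `F, G` measurable, bounded and supported on
`R_{n+1}` («This is a self-adjoint … operator on `L²(R_k)`»; it is what makes `M_2 = (⟨ℒ^{i+j−1}1,1⟩)` a
Hankel matrix). [cite: Polymath8b2014, §7.1 (p. 30)] -/
theorem integral_maynardOperator_mul_comm {F G : (Fin (n + 1) → ℝ) → ℝ}
    (hFm : Measurable F) (hF : ∀ t, t ∉ maynardSimplex (n + 1) → F t = 0) {B : ℝ}
    (hB : ∀ t ∈ maynardSimplex (n + 1), |F t| ≤ B)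
    (hGm : Measurable G) (hG : ∀ t, t ∉ maynardSimplex (n + 1) → G t = 0) {B' : ℝ}
    (hB' : ∀ t ∈ maynardSimplex (n + 1), |G t| ≤ B') :
    ∫ t, maynardOperator F t * G t = ∫ t, maynardOperator G t * F t := by
  have hB0 : 0 ≤ B := bound_nonneg hB
  have hB0' : 0 ≤ B' := bound_nonneg hB'
  have hiF : ∀ m, Integrable fun t => fibreIntegral m F t * G t := fun m =>
    integrable_mul_of_bdd (measurable_fibreIntegral m hFm)
      (fun t => by rw [← Fin.insertNth_self_removeNth m t]
                   exact abs_fibreIntegral_insertNth_le' m hF hB0 hB _ _) hGm hG hB'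
  have hiG : ∀ m, Integrable fun t => fibreIntegral m G t * F t := fun m =>
    integrable_mul_of_bdd (measurable_fibreIntegral m hGm)
      (fun t => by rw [← Fin.insertNth_self_removeNth m t]
                   exact abs_fibreIntegral_insertNth_le' m hG hB0' hB' _ _) hFm hF hB
  simp_rw [maynardOperator_def, Finset.sum_mul]
  rw [integral_finsetSum _ fun m _ => hiF m, integral_finsetSum _ fun m _ => hiG m]
  exact Finset.sum_congr rfl fun m _ => integral_fibreIntegral_mul_comm m hFm hF hB hGm hG hB'

/-- **`ℒ` is positive semi-definite**: `0 ≤ ∫ (ℒF)·F` for `F` measurable, bounded and supported on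
`R_{n+1}` (each `∫ (P_m F)·F = ∫_s (∫_{fibre} F)² ≥ 0`). [cite: Polymath8b2014, §7.1 (p. 30)] -/
theorem integral_maynardOperator_mul_self_nonneg {F : (Fin (n + 1) → ℝ) → ℝ}
    (hFm : Measurable F) (hF : ∀ t, t ∉ maynardSimplex (n + 1) → F t = 0) {B : ℝ}
    (hB : ∀ t ∈ maynardSimplex (n + 1), |F t| ≤ B) :
    0 ≤ ∫ t, maynardOperator F t * F t := by
  have hB0 : 0 ≤ B := bound_nonneg hB
  have hiF : ∀ m, Integrable fun t => fibreIntegral m F t * F t := fun m =>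
    integrable_mul_of_bdd (measurable_fibreIntegral m hFm)
      (fun t => by rw [← Fin.insertNth_self_removeNth m t]
                   exact abs_fibreIntegral_insertNth_le' m hF hB0 hB _ _) hFm hF hB
  simp_rw [maynardOperator_def, Finset.sum_mul]
  rw [integral_finsetSum _ fun m _ => hiF m]
  refine Finset.sum_nonneg fun m _ => ?_
  rw [integral_fibreIntegral_mul_eq m hFm hF hB hFm hF hB]
  exact integral_nonneg fun s => mul_self_nonneg _

/-! ### The operator of `L²(R_k)`: `ℒ` followed by restriction, its iterates, the Krylov moments -/

/-- One Krylov step `F ↦ 1_{R_{n+1}} · ℒF` — Polymath's `ℒ` as an operator of `L²(R_k)` (the values of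
`ℒF` off the simplex are discarded, as they must be to iterate: `b_i = ℒ^{i−1} 1 ∈ L²(R_k)`).
[cite: Polymath8b2014, §7.1 (p. 30)] -/
def krylovStep (F : (Fin (n + 1) → ℝ) → ℝ) : (Fin (n + 1) → ℝ) → ℝ :=
  (maynardSimplex (n + 1)).indicator (maynardOperator F)

/-- `krylovStep` unfolded. [cite: Polymath8b2014, §7.1 (p. 30)] -/
theorem krylovStep_def (F : (Fin (n + 1) → ℝ) → ℝ) :
    krylovStep F = (maynardSimplex (n + 1)).indicator (maynardOperator F) := rfl

/-- The `N`-th iterate `(1_R·ℒ)^N F`. [cite: Polymath8b2014, §7.1 (p. 30)] -/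
def krylovIter (N : ℕ) (F : (Fin (n + 1) → ℝ) → ℝ) : (Fin (n + 1) → ℝ) → ℝ :=
  krylovStep^[N] F

/-- The unit constant function `1` on `R_{n+1}` (zero elsewhere): the Krylov seed of §7.1.
[cite: Polymath8b2014, §7.1 (p. 30)] -/
def oneR : (Fin (n + 1) → ℝ) → ℝ :=
  (maynardSimplex (n + 1)).indicator 1

/-- The `N`-th **Krylov moment** `⟨ℒ^N 1, 1⟩ = ∫_{R_{n+1}} (ℒ^N 1)(t) dt` of §7.1 (the `2n` numbers from
which the Hankel matrices `M_1 = (⟨ℒ^{i+j−2}1,1⟩)`, `M_2 = (⟨ℒ^{i+j−1}1,1⟩)` are built; e.g.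
`⟨1,1⟩ = 1/k!`, `⟨ℒ1,1⟩ = 2k/(k+1)!`). [cite: Polymath8b2014, §7.1 (p. 30)] -/
def krylovMoment (n N : ℕ) : ℝ :=
  ∫ t, krylovIter N (oneR (n := n)) t * oneR (n := n) t

/-- `krylovIter 0 F = F`. [cite: Polymath8b2014, §7.1 (p. 30)] -/
theorem krylovIter_zero (F : (Fin (n + 1) → ℝ) → ℝ) : krylovIter 0 F = F := rfl

/-- `krylovIter (N+1) F = krylovStep (krylovIter N F)`. [cite: Polymath8b2014, §7.1 (p. 30)] -/
theorem krylovIter_succ (N : ℕ) (F : (Fin (n + 1) → ℝ) → ℝ) :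
    krylovIter (N + 1) F = krylovStep (krylovIter N F) := by
  rw [krylovIter, Function.iterate_succ_apply']; rfl

/-- `krylovIter (N+1) F = krylovIter N (krylovStep F)`. [cite: Polymath8b2014, §7.1 (p. 30)] -/
theorem krylovIter_succ' (N : ℕ) (F : (Fin (n + 1) → ℝ) → ℝ) :
    krylovIter (N + 1) F = krylovIter N (krylovStep F) := by
  rw [krylovIter, Function.iterate_succ_apply]; rfl

/-- `krylovMoment` unfolded. [cite: Polymath8b2014, §7.1 (p. 30)] -/
theorem krylovMoment_def (n N : ℕ) :
    krylovMoment n N = ∫ t, krylovIter N (oneR (n := n)) t * oneR (n := n) t := rfl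

/-- `krylovStep F` vanishes off `R_{n+1}`. [cite: Polymath8b2014, §7.1 (p. 30)] -/
theorem krylovStep_eq_zero {F : (Fin (n + 1) → ℝ) → ℝ} {t : Fin (n + 1) → ℝ}
    (ht : t ∉ maynardSimplex (n + 1)) : krylovStep F t = 0 :=
  Set.indicator_of_notMem ht _

/-- On `R_{n+1}`, `krylovStep F = ℒF`. [cite: Polymath8b2014, §7.1 (p. 30)] -/
theorem krylovStep_eq_of_mem {F : (Fin (n + 1) → ℝ) → ℝ} {t : Fin (n + 1) → ℝ}
    (ht : t ∈ maynardSimplex (n + 1)) : krylovStep F t = maynardOperator F t :=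
  Set.indicator_of_mem ht _

/-- `krylovStep F` is measurable for measurable `F`. [cite: Polymath8b2014, §7.1 (p. 30)] -/
theorem measurable_krylovStep {F : (Fin (n + 1) → ℝ) → ℝ} (hFm : Measurable F) :
    Measurable (krylovStep F) :=
  (measurable_maynardOperator hFm).indicator (measurableSet_maynardSimplex (n + 1))

/-- `|krylovStep F| ≤ (n+1)·B` on `R_{n+1}` for `F` supported on `R_{n+1}` with `|F| ≤ B` there.
[cite: Polymath8b2014, §7.1 (p. 30)] -/
theorem abs_krylovStep_le {F : (Fin (n + 1) → ℝ) → ℝ}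
    (hF : ∀ t, t ∉ maynardSimplex (n + 1) → F t = 0) {B : ℝ}
    (hB : ∀ t ∈ maynardSimplex (n + 1), |F t| ≤ B) (t : Fin (n + 1) → ℝ)
    (ht : t ∈ maynardSimplex (n + 1)) : |krylovStep F t| ≤ (n + 1) * B := by
  rw [krylovStep_eq_of_mem ht]
  exact abs_maynardOperator_le hF (bound_nonneg hB) hB t

/-- The iterates are measurable. [cite: Polymath8b2014, §7.1 (p. 30)] -/
theorem measurable_krylovIter {F : (Fin (n + 1) → ℝ) → ℝ} (hFm : Measurable F) (N : ℕ) :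
    Measurable (krylovIter N F) := by
  induction N with
  | zero => exact hFm
  | succ N ih => rw [krylovIter_succ]; exact measurable_krylovStep ih

/-- The iterates vanish off `R_{n+1}` (for `N ≥ 1` automatically; for `N = 0` by hypothesis).
[cite: Polymath8b2014, §7.1 (p. 30)] -/
theorem krylovIter_eq_zero {F : (Fin (n + 1) → ℝ) → ℝ}
    (hF : ∀ t, t ∉ maynardSimplex (n + 1) → F t = 0) (N : ℕ) :
    ∀ t, t ∉ maynardSimplex (n + 1) → krylovIter N F t = 0 := by
  induction N with
  | zero => exact hF
  | succ N _ => intro t ht; rw [krylovIter_succ]; exact krylovStep_eq_zero ht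

/-- The iterates are bounded: `|(1_R ℒ)^N F| ≤ (n+1)^N · B` on `R_{n+1}`. [cite: Polymath8b2014, §7.1 (p. 30)] -/
theorem abs_krylovIter_le_pow {F : (Fin (n + 1) → ℝ) → ℝ}
    (hF : ∀ t, t ∉ maynardSimplex (n + 1) → F t = 0) {B : ℝ}
    (hB : ∀ t ∈ maynardSimplex (n + 1), |F t| ≤ B) (N : ℕ) :
    ∀ t ∈ maynardSimplex (n + 1), |krylovIter N F t| ≤ (n + 1) ^ N * B := by
  induction N with
  | zero => intro t ht; simpa [krylovIter_zero] using hB t ht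
  | succ N ih =>
    intro t ht
    rw [krylovIter_succ]
    calc |krylovStep (krylovIter N F) t| ≤ (n + 1) * ((n + 1) ^ N * B) :=
          abs_krylovStep_le (krylovIter_eq_zero hF N) ih t ht
      _ = (n + 1) ^ (N + 1) * B := by ring

/-- `1 = 1_R` is measurable, vanishes off `R_{n+1}` and is bounded by `1` there. [cite: Polymath8b2014, §7.1 (p. 30)] -/
theorem oneR_props :
    Measurable (oneR (n := n)) ∧ (∀ t, t ∉ maynardSimplex (n + 1) → oneR (n := n) t = 0) ∧
      (∀ t ∈ maynardSimplex (n + 1), |oneR (n := n) t| ≤ 1) := by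
  refine ⟨measurable_one.indicator (measurableSet_maynardSimplex (n + 1)),
    fun t ht => Set.indicator_of_notMem ht _, fun t ht => ?_⟩
  simp [oneR, Set.indicator_of_mem ht]

/-- Value of `1_R` on the simplex. [cite: Polymath8b2014, §7.1 (p. 30)] -/
theorem oneR_of_mem {t : Fin (n + 1) → ℝ} (ht : t ∈ maynardSimplex (n + 1)) : oneR (n := n) t = 1 := by
  simp [oneR, Set.indicator_of_mem ht]

/-! ### Self-adjointness of the Krylov step and the moment inequalities -/

/-- `∫ (1_R ℒF)·G = ∫ (1_R ℒG)·F` for `F, G` measurable, bounded and supported on `R_{n+1}` (the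
restriction is invisible against a function supported on `R_{n+1}`). [cite: Polymath8b2014, §7.1 (p. 30)] -/
theorem integral_krylovStep_mul_comm {F G : (Fin (n + 1) → ℝ) → ℝ}
    (hFm : Measurable F) (hF : ∀ t, t ∉ maynardSimplex (n + 1) → F t = 0) {B : ℝ}
    (hB : ∀ t ∈ maynardSimplex (n + 1), |F t| ≤ B)
    (hGm : Measurable G) (hG : ∀ t, t ∉ maynardSimplex (n + 1) → G t = 0) {B' : ℝ}
    (hB' : ∀ t ∈ maynardSimplex (n + 1), |G t| ≤ B') :
    ∫ t, krylovStep F t * G t = ∫ t, krylovStep G t * F t := by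
  have h1 : (fun t => krylovStep F t * G t) = fun t => maynardOperator F t * G t := by
    funext t
    by_cases ht : t ∈ maynardSimplex (n + 1)
    · rw [krylovStep_eq_of_mem ht]
    · rw [krylovStep_eq_zero ht, hG t ht, mul_zero, mul_zero]
  have h2 : (fun t => krylovStep G t * F t) = fun t => maynardOperator G t * F t := by
    funext t
    by_cases ht : t ∈ maynardSimplex (n + 1)
    · rw [krylovStep_eq_of_mem ht]
    · rw [krylovStep_eq_zero ht, hF t ht, mul_zero, mul_zero]
  rw [h1, h2]
  exact integral_maynardOperator_mul_comm hFm hF hB hGm hG hB'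

/-- Shifting one `ℒ` across the inner product: `⟨ℒ^{a+1}F, ℒ^b F⟩ = ⟨ℒ^a F, ℒ^{b+1} F⟩`.
[cite: Polymath8b2014, §7.1 (p. 30)] -/
theorem integral_krylovIter_succ_mul {F : (Fin (n + 1) → ℝ) → ℝ}
    (hFm : Measurable F) (hF : ∀ t, t ∉ maynardSimplex (n + 1) → F t = 0) {B : ℝ}
    (hB : ∀ t ∈ maynardSimplex (n + 1), |F t| ≤ B) (a b : ℕ) :
    ∫ t, krylovIter (a + 1) F t * krylovIter b F t = ∫ t, krylovIter a F t * krylovIter (b + 1) F t := by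
  rw [krylovIter_succ, krylovIter_succ]
  rw [integral_krylovStep_mul_comm (measurable_krylovIter hFm a) (krylovIter_eq_zero hF a)
      (abs_krylovIter_le_pow hF hB a) (measurable_krylovIter hFm b) (krylovIter_eq_zero hF b)
      (abs_krylovIter_le_pow hF hB b)]
  simp_rw [mul_comm]

/-- The Hankel property: `⟨ℒ^a F, ℒ^b F⟩` depends only on `a + b`; in particular
`⟨ℒ^a F, ℒ^b F⟩ = ⟨ℒ^{a+b} F, F⟩`. [cite: Polymath8b2014, §7.1 (p. 30)] -/
theorem integral_krylovIter_mul_krylovIter {F : (Fin (n + 1) → ℝ) → ℝ}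
    (hFm : Measurable F) (hF : ∀ t, t ∉ maynardSimplex (n + 1) → F t = 0) {B : ℝ}
    (hB : ∀ t ∈ maynardSimplex (n + 1), |F t| ≤ B) (a b : ℕ) :
    ∫ t, krylovIter a F t * krylovIter b F t = ∫ t, krylovIter (a + b) F t * F t := by
  induction b generalizing a with
  | zero => simp [krylovIter_zero]
  | succ b ih =>
    rw [show a + (b + 1) = (a + 1) + b from by ring, ← ih (a + 1)]
    exact (integral_krylovIter_succ_mul hFm hF hB a b).symm

/-- **The moment inequality** `⟨ℒ^j F, F⟩² ≤ ⟨ℒ^{2j} F, F⟩ · ⟨F, F⟩` (Cauchy–Schwarz and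
`⟨ℒ^jF, ℒ^jF⟩ = ⟨ℒ^{2j}F, F⟩`) — log-convexity of the moment sequence of the spectral measure of `F`.
[cite: GolubVanLoan2013, §10.1.5, Theorem 10.1.2] -/
theorem sq_integral_krylovIter_mul_le {F : (Fin (n + 1) → ℝ) → ℝ}
    (hFm : Measurable F) (hF : ∀ t, t ∉ maynardSimplex (n + 1) → F t = 0) {B : ℝ}
    (hB : ∀ t ∈ maynardSimplex (n + 1), |F t| ≤ B) (j : ℕ) :
    (∫ t, krylovIter j F t * F t) ^ 2 ≤ (∫ t, krylovIter (2 * j) F t * F t) * ∫ t, F t ^ 2 := by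
  have hB0 : 0 ≤ B := bound_nonneg hB
  have hPm := measurable_krylovIter hFm j
  have hP0 := krylovIter_eq_zero hF j
  have hPb := abs_krylovIter_le_pow hF hB j
  have hPall : ∀ t, |krylovIter j F t| ≤ (n + 1) ^ j * B := fun t => by
    by_cases ht : t ∈ maynardSimplex (n + 1)
    · exact hPb t ht
    · rw [hP0 t ht, abs_zero]; positivity
  have hFall : ∀ t, |F t| ≤ B := fun t => by
    by_cases ht : t ∈ maynardSimplex (n + 1)
    · exact hB t ht
    · rw [hF t ht, abs_zero]; exact hB0
  have hPP : Integrable fun t => krylovIter j F t * krylovIter j F t :=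
    integrable_mul_of_bdd hPm hPall hPm hP0 hPb
  have hFF : Integrable fun t => F t * F t := integrable_mul_of_bdd hFm hFall hFm hF hB
  have hPF : Integrable fun t => krylovIter j F t * F t := integrable_mul_of_bdd hPm hPall hFm hF hB
  have h := sq_integral_mul_le (μ := volume) (f := krylovIter j F) (g := F)
    (by simpa [sq] using hPP) (by simpa [sq] using hFF) hPF
  have hsq : (∫ t, krylovIter j F t ^ 2) = ∫ t, krylovIter (2 * j) F t * F t := by
    have := integral_krylovIter_mul_krylovIter hFm hF hB j j
    simp_rw [← sq] at this
    rw [this, two_mul]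
  rwa [hsq] at h

/-- `0 ≤ ⟨(1_R ℒ)F, F⟩ = ⟨ℒF, F⟩`. [cite: Polymath8b2014, §7.1 (p. 30)] -/
theorem integral_krylovIter_one_mul_nonneg {F : (Fin (n + 1) → ℝ) → ℝ}
    (hFm : Measurable F) (hF : ∀ t, t ∉ maynardSimplex (n + 1) → F t = 0) {B : ℝ}
    (hB : ∀ t ∈ maynardSimplex (n + 1), |F t| ≤ B) :
    0 ≤ ∫ t, krylovIter 1 F t * F t := by
  have h1 : (fun t => krylovIter 1 F t * F t) = fun t => maynardOperator F t * F t := by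
    funext t
    rw [krylovIter_succ, krylovIter_zero]
    by_cases ht : t ∈ maynardSimplex (n + 1)
    · rw [krylovStep_eq_of_mem ht]
    · rw [krylovStep_eq_zero ht, hF t ht, mul_zero, mul_zero]
  rw [h1]; exact integral_maynardOperator_mul_self_nonneg hFm hF hB

/-- **Power form of the moment inequality**: `⟨ℒF, F⟩^{2^s} ≤ ⟨ℒ^{2^s}F, F⟩ · ⟨F, F⟩^{2^s − 1}` for every
`s` (induction on `s` with `sq_integral_krylovIter_mul_le` at `j = 2^s`).
[cite: GolubVanLoan2013, §10.1.5, Theorem 10.1.2] -/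
theorem pow_integral_krylovIter_one_mul_le {F : (Fin (n + 1) → ℝ) → ℝ}
    (hFm : Measurable F) (hF : ∀ t, t ∉ maynardSimplex (n + 1) → F t = 0) {B : ℝ}
    (hB : ∀ t ∈ maynardSimplex (n + 1), |F t| ≤ B) (s : ℕ) :
    (∫ t, krylovIter 1 F t * F t) ^ (2 ^ s) ≤
      (∫ t, krylovIter (2 ^ s) F t * F t) * (∫ t, F t ^ 2) ^ (2 ^ s - 1) := by
  have ha1 : 0 ≤ ∫ t, krylovIter 1 F t * F t := integral_krylovIter_one_mul_nonneg hFm hF hB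
  have ha0 : 0 ≤ ∫ t, F t ^ 2 := integral_nonneg fun t => sq_nonneg _
  induction s with
  | zero => simp
  | succ s ih =>
    have hcs := sq_integral_krylovIter_mul_le hFm hF hB (2 ^ s)
    have hpos : 0 ≤ (∫ t, krylovIter 1 F t * F t) ^ (2 ^ s) := pow_nonneg ha1 _
    calc (∫ t, krylovIter 1 F t * F t) ^ (2 ^ (s + 1))
        = ((∫ t, krylovIter 1 F t * F t) ^ (2 ^ s)) ^ 2 := by rw [pow_succ, pow_mul]
      _ ≤ ((∫ t, krylovIter (2 ^ s) F t * F t) * (∫ t, F t ^ 2) ^ (2 ^ s - 1)) ^ 2 :=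
          pow_le_pow_left₀ hpos ih 2
      _ = (∫ t, krylovIter (2 ^ s) F t * F t) ^ 2 * ((∫ t, F t ^ 2) ^ (2 ^ s - 1)) ^ 2 := by ring
      _ ≤ ((∫ t, krylovIter (2 * 2 ^ s) F t * F t) * ∫ t, F t ^ 2) *
            ((∫ t, F t ^ 2) ^ (2 ^ s - 1)) ^ 2 :=
          mul_le_mul_of_nonneg_right hcs (pow_nonneg (pow_nonneg ha0 _) _)
      _ = (∫ t, krylovIter (2 ^ (s + 1)) F t * F t) * (∫ t, F t ^ 2) ^ (2 ^ (s + 1) - 1) := by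
          have h2 : 2 ^ (s + 1) = 2 * 2 ^ s := by ring
          have h3 : 2 * 2 ^ s - 1 = (2 ^ s - 1) + (2 ^ s - 1) + 1 := by
            have : 1 ≤ 2 ^ s := Nat.one_le_two_pow
            omega
          rw [h2, h3]
          ring

/-! ### Positivity preservation: `|ℒ^N F| ≤ B · ℒ^N 1` -/

/-- **Monotonicity of the Krylov step**: if `|G| ≤ H` pointwise with `G, H` measurable, bounded and
supported on `R_{n+1}`, then `|1_R ℒG| ≤ 1_R ℒH` pointwise (`ℒ` is positivity-preserving: its kernel is
an indicator). [cite: Polymath8b2014, §7.1 (p. 30)] -/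
theorem abs_krylovStep_le_krylovStep {G H : (Fin (n + 1) → ℝ) → ℝ} (hHm : Measurable H)
    (hH : ∀ t, t ∉ maynardSimplex (n + 1) → H t = 0) {B : ℝ}
    (hHB : ∀ t ∈ maynardSimplex (n + 1), |H t| ≤ B) (hGH : ∀ t, |G t| ≤ H t) (t : Fin (n + 1) → ℝ) :
    |krylovStep G t| ≤ krylovStep H t := by
  by_cases ht : t ∈ maynardSimplex (n + 1)
  · rw [krylovStep_eq_of_mem ht, krylovStep_eq_of_mem ht, maynardOperator_def, maynardOperator_def]
    refine (Finset.abs_sum_le_sum_abs _ _).trans (Finset.sum_le_sum fun m _ => ?_)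
    -- on the fibre through `t`
    rw [← Fin.insertNth_self_removeNth m t, fibreIntegral_insertNth, fibreIntegral_insertNth]
    set s := Fin.removeNth m t with hs_def
    have hs : ∀ j, 0 ≤ s j := fun j => by rw [hs_def]; exact ht.1 _
    have hHi : IntegrableOn (fun v => H (Fin.insertNth m v s)) (Ioc (0:ℝ) (1 - ∑ j, s j)) := by
      have hgm : Measurable fun v : ℝ => H (Fin.insertNth m v s) :=
        hHm.comp (continuous_id.finInsertNth m continuous_const).measurable
      refine Measure.integrableOn_of_bounded (M := B) (by simp [Real.volume_Ioc]) hgm.aestronglyMeasurable ?_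
      rw [ae_restrict_iff' measurableSet_Ioc]
      refine ae_of_all _ fun v hv => ?_
      rw [Real.norm_eq_abs]
      by_cases hv' : Fin.insertNth m v s ∈ maynardSimplex (n + 1)
      · exact hHB _ hv'
      · rw [hH _ hv', abs_zero]; exact bound_nonneg hHB
    calc |∫ v in Ioc (0:ℝ) (1 - ∑ j, s j), G (Fin.insertNth m v s)|
        ≤ ∫ v in Ioc (0:ℝ) (1 - ∑ j, s j), |G (Fin.insertNth m v s)| := by
          rw [← Real.norm_eq_abs]
          exact (norm_integral_le_integral_norm _).trans (le_of_eq (by simp [Real.norm_eq_abs]))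
      _ ≤ ∫ v in Ioc (0:ℝ) (1 - ∑ j, s j), H (Fin.insertNth m v s) := by
          refine integral_mono_of_nonneg (ae_of_all _ fun v => abs_nonneg _) hHi
            (ae_of_all _ fun v => hGH _)
  · rw [krylovStep_eq_zero ht, krylovStep_eq_zero ht, abs_zero]

/-- Linearity in a constant: `1_R ℒ(c·H) = c · 1_R ℒH`. [cite: Polymath8b2014, §7.1 (p. 30)] -/
theorem krylovStep_const_mul (c : ℝ) (H : (Fin (n + 1) → ℝ) → ℝ) :
    krylovStep (fun t => c * H t) = fun t => c * krylovStep H t := by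
  funext t
  by_cases ht : t ∈ maynardSimplex (n + 1)
  · rw [krylovStep_eq_of_mem ht, krylovStep_eq_of_mem ht, maynardOperator_def, maynardOperator_def,
      Finset.mul_sum]
    refine Finset.sum_congr rfl fun m _ => ?_
    simp only [fibreIntegral]
    rw [← integral_const_mul]
  · rw [krylovStep_eq_zero ht, krylovStep_eq_zero ht, mul_zero]

/-- **Positivity preservation along the Krylov iteration**: for `F` measurable, supported on `R_{n+1}`
and bounded by `B` there, `|(1_Rℒ)^N F| ≤ B · (1_Rℒ)^N 1` pointwise, for every `N`.
[cite: Polymath8b2014, §7.1 (p. 30)] -/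
theorem abs_krylovIter_le {F : (Fin (n + 1) → ℝ) → ℝ}
    (hF : ∀ t, t ∉ maynardSimplex (n + 1) → F t = 0) {B : ℝ}
    (hB : ∀ t ∈ maynardSimplex (n + 1), |F t| ≤ B) (N : ℕ) :
    ∀ t, |krylovIter N F t| ≤ B * krylovIter N (oneR (n := n)) t := by
  have hB0 : 0 ≤ B := bound_nonneg hB
  obtain ⟨h1m, h10, h1b⟩ := oneR_props (n := n)
  induction N with
  | zero =>
    intro t
    rw [krylovIter_zero, krylovIter_zero]
    by_cases ht : t ∈ maynardSimplex (n + 1)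
    · rw [oneR_of_mem ht, mul_one]; exact hB t ht
    · rw [hF t ht, h10 t ht, abs_zero, mul_zero]
  | succ N ih =>
    intro t
    rw [krylovIter_succ, krylovIter_succ]
    -- `H := B · (1_Rℒ)^N 1` is measurable, supported on `R`, bounded, and dominates `|(1_Rℒ)^N F|`
    have hHm : Measurable fun t => B * krylovIter N (oneR (n := n)) t :=
      (measurable_krylovIter h1m N).const_mul B
    have hH0 : ∀ t, t ∉ maynardSimplex (n + 1) → B * krylovIter N (oneR (n := n)) t = 0 :=
      fun t ht => by rw [krylovIter_eq_zero h10 N t ht, mul_zero]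
    have hHB : ∀ t ∈ maynardSimplex (n + 1), |B * krylovIter N (oneR (n := n)) t| ≤ B * ((n + 1) ^ N * 1) :=
      fun t ht => by
        rw [abs_mul, abs_of_nonneg hB0]
        exact mul_le_mul_of_nonneg_left (abs_krylovIter_le_pow h10 h1b N t ht) hB0
    have hstep := abs_krylovStep_le_krylovStep hHm hH0 hHB ih t
    rw [krylovStep_const_mul] at hstep
    exact hstep

/-- `⟨ℒ^N F, F⟩ ≤ B² · ⟨ℒ^N 1, 1⟩` for `F` measurable, supported on `R_{n+1}` and bounded by `B` there.
[cite: Polymath8b2014, §7.1 (p. 30)] -/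
theorem integral_krylovIter_mul_le_krylovMoment {F : (Fin (n + 1) → ℝ) → ℝ}
    (hFm : Measurable F) (hF : ∀ t, t ∉ maynardSimplex (n + 1) → F t = 0) {B : ℝ}
    (hB : ∀ t ∈ maynardSimplex (n + 1), |F t| ≤ B) (N : ℕ) :
    ∫ t, krylovIter N F t * F t ≤ B ^ 2 * krylovMoment n N := by
  have hB0 : 0 ≤ B := bound_nonneg hB
  obtain ⟨h1m, h10, h1b⟩ := oneR_props (n := n)
  rw [krylovMoment_def, ← integral_const_mul]
  have hdom := abs_krylovIter_le hF hB N
  -- integrability of both sides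
  have hPall : ∀ t, |krylovIter N F t| ≤ (n + 1) ^ N * B := fun t => by
    by_cases ht : t ∈ maynardSimplex (n + 1)
    · exact abs_krylovIter_le_pow hF hB N t ht
    · rw [krylovIter_eq_zero hF N t ht, abs_zero]; positivity
  have hQall : ∀ t, |krylovIter N (oneR (n := n)) t| ≤ (n + 1) ^ N * 1 := fun t => by
    by_cases ht : t ∈ maynardSimplex (n + 1)
    · exact abs_krylovIter_le_pow h10 h1b N t ht
    · rw [krylovIter_eq_zero h10 N t ht, abs_zero]; positivity
  have hiL : Integrable fun t => krylovIter N F t * F t :=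
    integrable_mul_of_bdd (measurable_krylovIter hFm N) hPall hFm hF hB
  have hiR : Integrable fun t => B ^ 2 * (krylovIter N (oneR (n := n)) t * oneR (n := n) t) :=
    (integrable_mul_of_bdd (measurable_krylovIter h1m N) hQall h1m h10 h1b).const_mul _
  refine integral_mono hiL hiR fun t => ?_
  dsimp only
  by_cases ht : t ∈ maynardSimplex (n + 1)
  · rw [oneR_of_mem ht, mul_one]
    have hFt : |F t| ≤ B := hB t ht
    have h1 : krylovIter N F t * F t ≤ |krylovIter N F t| * |F t| := by
      rw [← abs_mul]; exact le_abs_self _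
    have h2 : |krylovIter N F t| * |F t| ≤ (B * krylovIter N (oneR (n := n)) t) * B :=
      mul_le_mul (hdom t) hFt (abs_nonneg _) ((abs_nonneg _).trans (hdom t))
    nlinarith [h1, h2]
  · rw [hF t ht, krylovIter_eq_zero h10 N t ht]; simp

end MaynardCW

/-! ### The headline: Krylov moments of `1` bound the Maynard functional of every bounded test function -/

open MaynardCW in
/-- **The Krylov moments `⟨ℒ^N 1, 1⟩` bound `M_k` from above.**  Let `F` be measurable, supported on
`R_{n+1}`, bounded by `B` there, with `I(F) > 0`.  Then for every `s`,
`((∑_m J^{(m)}(F)) / I(F))^{2^s} · I(F) ≤ B² · ⟨ℒ^{2^s} 1, 1⟩`.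
Proof: `(∑J)/I = ⟨ℒF,F⟩/⟨F,F⟩` (`maynardFunctional_eq_rayleigh`); `⟨ℒF,F⟩^{2^s} ≤ ⟨ℒ^{2^s}F,F⟩⟨F,F⟩^{2^s−1}`
(self-adjointness + Cauchy–Schwarz, `pow_integral_krylovIter_one_mul_le`); and
`⟨ℒ^{2^s}F,F⟩ ≤ B²⟨ℒ^{2^s}1,1⟩` (positivity preservation, `integral_krylovIter_mul_le_krylovMoment`).
Hence every such `F` has `(∑J/I)(F) ≤ (B²/I(F))^{2^{−s}} ⟨ℒ^{2^s}1,1⟩^{2^{−s}}`: the moments of the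
single seed `1` of Polymath's Krylov method determine `M_k` (their `N`-th roots converge to it from
above in the limit, while the Ritz values built from them are lower bounds) — the Krylov process from
`1` «leads to» `M_k` itself, not only to lower bounds.
[cite: Polymath8b2014, §7.1 (p. 30); GolubVanLoan2013, §10.1.5 Theorem 10.1.2] -/
theorem maynardFunctional_pow_mul_maynardI_le_krylovMoment {n : ℕ} {F : (Fin (n + 1) → ℝ) → ℝ}
    (hFm : Measurable F) (hF : ∀ t, t ∉ maynardSimplex (n + 1) → F t = 0) {B : ℝ}
    (hB : ∀ t ∈ maynardSimplex (n + 1), |F t| ≤ B) (hI : 0 < maynardI (n + 1) F) (s : ℕ) :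
    maynardFunctional (n + 1) F ^ (2 ^ s) * maynardI (n + 1) F ≤
      B ^ 2 * MaynardCW.krylovMoment n (2 ^ s) := by
  -- `I(F) = ∫ F² = a₀`, `(∑J)/I = a₁/a₀`
  have hIeq : maynardI (n + 1) F = ∫ t, F t ^ 2 := by
    refine setIntegral_eq_integral_of_forall_compl_eq_zero fun t ht => ?_
    simp [hF t ht]
  have ha1eq : (∫ t, maynardOperator F t * F t) = ∫ t, krylovIter 1 F t * F t := by
    refine integral_congr_ae (ae_of_all _ fun t => ?_)
    dsimp only
    rw [krylovIter_succ, krylovIter_zero]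
    by_cases ht : t ∈ maynardSimplex (n + 1)
    · rw [krylovStep_eq_of_mem ht]
    · rw [krylovStep_eq_zero ht, hF t ht, mul_zero, mul_zero]
  set a0 := ∫ t, F t ^ 2 with ha0_def
  set a1 := ∫ t, krylovIter 1 F t * F t with ha1_def
  set aN := ∫ t, krylovIter (2 ^ s) F t * F t with haN_def
  have ha0 : 0 < a0 := by rwa [← hIeq]
  have hM : maynardFunctional (n + 1) F = a1 / a0 := by
    rw [maynardFunctional_eq_rayleigh hFm hF hB, ha1eq]
  have hpow : a1 ^ (2 ^ s) ≤ aN * a0 ^ (2 ^ s - 1) := pow_integral_krylovIter_one_mul_le hFm hF hB s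
  have hcmp : aN ≤ B ^ 2 * krylovMoment n (2 ^ s) := integral_krylovIter_mul_le_krylovMoment hFm hF hB _
  have hNpos : 1 ≤ 2 ^ s := Nat.one_le_two_pow
  rw [hM, hIeq]
  have ha0pow : 0 < a0 ^ (2 ^ s) := pow_pos ha0 _
  have e : a0 ^ (2 ^ s) = a0 ^ (2 ^ s - 1) * a0 := by
    rw [← pow_succ, Nat.sub_add_cancel hNpos]
  have h1 : (a1 / a0) ^ (2 ^ s) * a0 ≤ aN := by
    rw [div_pow, div_mul_eq_mul_div, div_le_iff₀ ha0pow, e, ← mul_assoc]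
    exact mul_le_mul_of_nonneg_right hpow ha0.le
  exact h1.trans hcmp

end Literature.NumberTheory.Sieve

end
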